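import Literature.Computability.Complexity.Williams2014SatInstance
import Literature.Computability.Complexity.PrefixVerifiers
import Literature.Computability.Complexity.MapFstMachine
import Literature.Computability.Complexity.NSUBEXPGuardedBall
import Literature.Computability.Complexity.PlumbingBricks
import HarnessLib

/-!
# Williams' Theorem 3.2, the machine `B`: assembly from its stages

Fifth layer under `williams_acc`, directly under the named fact
`Williams2014_thm_3_2_machineB` (`Williams2014Lemma31.lean`; R. Williams, *Nonuniform ACC
circuit lower bounds*, J. ACM 61 (2014), proof of Thm. 3.2, pp. 12–13: "`B` first runs the
nondeterministic algorithm `A` of Lemma 3.1 … Then `B` nondeterministically guesses a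
`S(3n)`-size circuit `W` … constructs an `ACC` CIRCUIT SAT instance `D` to verify that `W` is
correct … By assumption, the satisfiability of `D` can be determined in `O(2ⁿ/nᶜ)` time, hence
`B` decides if `x ∈ L` in `O(2ⁿ/nᶜ)` time").

This file PROVES the machine `B` from three string-processing stages, which are the only
constructions left (they are built in the companion files): the verifier of `L` at level
`williamsBound` is the pipeline

  `truncMapAux N' ▸ P₁ ▸ mapFstAux A ▸ P₃ ▸ M_F ▸ flagAux M_SAT ▸ compl`

on the pair word `⟨x, y⟩`, where

* `N'` is the unary clock of the admissible certificate length `s(x) = c'·t(n) + c'`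
  (`exists_unaryClock_of_timeConstructible`, `IsTimeConstructible.mul_add`,
  `isTimeConstructible_williamsBound`) followed by the polynomial-time preprocessing
  `x ↦ ⟨x, 1^{q(n)}⟩` (a yardstick for the length of the guessed circuit `W`), so that the
  truncating wrapper (`TruncMapMachine.lean`) hands on `⟨⟨x, 1^{q(n)}⟩, z⟩`, `z = y ↾ s(x)`;
* `P₁` (stage 1, linear time) re-associates: `⟨⟨x, u⟩, z⟩ ↦ ⟨⟨x, z₁⟩, guardLen |u| z₂⟩`,
  `(z₁, z₂) = boolUnpair z` — `z₁` is the guess of the generator `A`, `z₂` the code of `W`, cut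
  to `ε` if longer than the yardstick;
* `mapFstAux A` (`MapFstMachine.lean`) runs the generator of Lemma 3.1 (`NGenerates`) on
  `⟨x, z₁⟩`: `↦ ⟨ok :: out, g⟩`;
* `P₃` (stage 3, linear time) dispatches on the flag: `⟨1 out, g⟩ ↦ 1 ⟨out, g⟩`, anything
  else `↦ 00` (discarding a possibly exponentially long garbage `out` at linear cost);
* `M_F` is the machine of an `FP` function `F` (stage `F`, `SatInstanceFn.Spec`): on `1 ⟨out, g⟩`
  it parses `g` as the code of a circuit `W` on `w` inputs over `accBasis m` of bounded depth
  and size (`w` is read off `out`, which is trusted once `ok = 1`) and prints `1` followed by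
  the code of the SAT instance `D = circuit G W` (the witness-check circuit of
  `Williams2014SatInstance.lean`, not fan-in–normalised), or `00` if `g` is not such a code;
  `00 ↦ 00`;
* `flagAux M_SAT (fun _ ↦ [1])` (`NSUBEXPGuardedBall.lean`) runs the `ACC`-SAT algorithm on
  `1 code` and answers `[1]` on `0 b`; `complMachine` negates: `B` accepts iff `A` accepted, `W`
  parsed and `D` is UNSATISFIABLE.

Main results (all proved):

* `mem_NTIME_of_prefixMachine_pre` — the packaging theorem of `PrefixVerifiers.lean` with a
  preprocessed first component (`N : x ↦ ⟨pre x, 1^{s x}⟩`);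
* `two_pow_succinctWidth_div_le`, `satTime_le_williamsBound` — the SAT call at width
  `w = n + c log n + c` and exponent `k = c + 1` costs `O(n + 2ⁿ/n)`:
  `2ʷ / w^{c+1} ≤ 2ᶜ · (2ⁿ / n) + 2ᶜ`;
* `MachineB.length_encodeAccCircuit_le`, `MachineB.length_encodeAccCircuitList_le` — code
  lengths are polynomial in inputs, size and fan-in (`MachineB.codeLen`);
* `MachineB.clauseCircuits_eq_of_encode_eq` — the printout of the generator determines the
  clause circuits;
* the stage specifications `ReassocMachine` (stage 1), `OkDispatchMachine` (stage 3),
  `SatInstanceFn.Spec` (stage `F`), with `guardLen`, `okToken`, `wSize`;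
* `MachineB.accept`, `MachineB.accept_iff` — the acceptance relation of `B` and its
  correctness; `MachineB.core_outputsWithin` — the output and running time (`MachineB.coreTime`)
  of the core machine; `MachineB.coreTime_le` — it is `O(williamsBound n)`;
* **`Williams2014_thm_3_2_machineB_of_stages`** — the machine `B`: from machines for the stages
  `P₁`, `P₃` and `FP` functions with `SatInstanceFn.Spec` (for all depth/size parameters), every
  `c` admits `k = c + 1` in `Williams2014_thm_3_2_machineB`.

## Faithfulness notes

* The certificate of `B` is `z = ⟨z₁, code W⟩`: the guesses of `A` and the code
  (`encodeAccCircuit m`) of the witness circuit `W`, padded to exactly `w` inputs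
  (`Circuit.exists_padInputs`) and fan-in–normalised (`Circuit.normFanIn`), so that its code has
  polynomial length; `F` checks `w` inputs, gates of `accBasis m`, `acDepth ≤ d_W + 3`,
  `size ≤ w^e + e + w + 2` (`wSize`); the fan-in of the parsed `W` is at most the length of
  its code, i.e. the yardstick; these are exactly the quantities that put `D` into the class on
  which the SAT algorithm is specified (`MachineB.circuit_spec`), at depth `d_W + d_G + 7` and a
  polynomial size/fan-in bound in `w` (`MachineB.exists_dExp`).
* Running time: every stage is `O(t(n) + |z|)` except `F` and the preprocessing, which are
  polynomial in `n` (the input of `F` has polynomial length as soon as `ok = 1`, and is `00`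
  otherwise), and the SAT call, `O(2ʷ/w^{c+1}) = O(2ⁿ/n)`; `|z| ≤ s(x) = O(t(n))`.

## References

* R. Williams, *Nonuniform ACC circuit lower bounds*, J. ACM 61(1) (2014) 2:1–2:32, proof of
  Thm. 3.2 (pp. 12–13), proof of Thm. 1.1 (p. 18) [Williams2014].
* S. Arora, B. Barak, *Computational Complexity: A Modern Approach*, CUP 2009, Def. 2.1 and
  §2.1.2 (verifier form of `NTIME`), §1.3 (machine constructions) [AroraBarak2009].
-/

namespace Literature.Computability.Complexity

open _root_.Computability Turing Polynomial

/-! ### The packaging theorem with a preprocessed first component -/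

/-- **A language presented by a prefix-reading machine behind a preprocessing is in `NTIME f`
for every dominating `f`** (variant of `mem_NTIME_of_prefixMachine`, `PrefixVerifiers.lean`):
the clock may output `⟨pre x, 1^{s x}⟩` for any preprocessing `pre` of `x`; the truncating
wrapper then hands `⟨pre x, y ↾ s x⟩` to `M₀` (`outputsWithin_truncMapAux_boolPair`).
[cite: AroraBarak2009, §2.1.2 and Thm. 2.6] -/
theorem mem_NTIME_of_prefixMachine_pre {f : ℕ → ℕ} {L : Language Bool}
    (pre : List Bool → List Bool) (s : List Bool → ℕ)
    (R₀ : List Bool → List Bool → Bool) (N M₀ : TM2ComputableAux Bool Bool)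
    (τ₁ τ₂ : List Bool → ℕ)
    (hN : ∀ x : List Bool, N.OutputsWithin x (boolPair (pre x) (List.replicate (s x) true)) (τ₁ x))
    (hM₀ : ∀ x z : List Bool, z.length ≤ s x →
      M₀.OutputsWithin (boolPair (pre x) z) (encodeBool (R₀ x z)) (τ₂ x))
    (hL : ∀ x : List Bool, x ∈ L ↔ ∃ z : List Bool, z.length ≤ s x ∧ R₀ x z = true)
    (c : ℕ) (hτ : ∀ x : List Bool, τ₁ x + τ₂ x + s x + (pre x).length + x.length ≤ c * f x.length + c) :
    L ∈ NTIME f := by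
  refine ⟨10 * c + 24, fun x y => R₀ x (y.take (s x)), (truncMapAux N).comp M₀,
    fun x y hy => ?_, fun x => ?_⟩
  · have h₁ := outputsWithin_truncMapAux_boolPair N (y := y) (hN x)
    simp only [List.length_replicate] at h₁
    have h₂ := hM₀ x (y.take (s x)) (List.length_take_le _ _)
    have h := TM2ComputableAux.comp_outputsWithin _ _ h₁ h₂
    refine h.mono ?_
    have hτx := hτ x
    set F := f x.length with hF
    have e2 : (10 * c + 24) * F = 10 * (c * F) + 24 * F := by ring
    omega
  · rw [hL x]
    constructor
    · rintro ⟨z, hz, hR⟩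
      refine ⟨z, ?_, ?_⟩
      · have hτx := hτ x
        have e2 : (10 * c + 24) * f x.length = 10 * (c * f x.length) + 24 * f x.length := by ring
        omega
      · show R₀ x (z.take (s x)) = true
        rwa [List.take_of_length_le hz]
    · rintro ⟨y, -, hR⟩
      exact ⟨y.take (s x), List.length_take_le _ _, hR⟩

/-! ### Arithmetic of the SAT call at width `w = n + c log n + c` -/

/-- `2 ^ succinctWidth c n ≤ 2ᶜ · 2ⁿ · nᶜ` for `n ≥ 1` (`2^{log₂ n} ≤ n`). [folklore] -/
theorem two_pow_succinctWidth_le {c n : ℕ} (hn : 1 ≤ n) :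
    2 ^ succinctWidth c n ≤ 2 ^ c * 2 ^ n * n ^ c := by
  unfold succinctWidth
  have hlog : 2 ^ Nat.log 2 n ≤ n := Nat.pow_log_le_self 2 (by omega)
  calc 2 ^ (n + c * Nat.log 2 n + c) = 2 ^ n * (2 ^ Nat.log 2 n) ^ c * 2 ^ c := by
        rw [pow_add, pow_add, mul_comm c (Nat.log 2 n), pow_mul]
    _ ≤ 2 ^ n * n ^ c * 2 ^ c := by gcongr
    _ = 2 ^ c * 2 ^ n * n ^ c := by ring

/-- **The SAT call costs `O(n + 2ⁿ/n)`**: at width `w = succinctWidth c n` and exponent `c + 1`,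
`2ʷ / w^{c+1} ≤ 2ᶜ · (2ⁿ / n) + 2ᶜ` (Williams 2014, p. 13: "the satisfiability of `D` can be
determined in `O(2ⁿ/nᶜ)` time" for `c` large against the `O(log n)` extra inputs).
[cite: Williams2014, proof of Thm. 3.2 (p. 13)] -/
theorem two_pow_succinctWidth_div_le (c n : ℕ) :
    2 ^ succinctWidth c n / succinctWidth c n ^ (c + 1) ≤ 2 ^ c * (2 ^ n / n) + 2 ^ c := by
  rcases Nat.eq_zero_or_pos n with rfl | hn
  · -- `w = c`: `2ᶜ / c^{c+1} ≤ 2ᶜ`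
    have : succinctWidth c 0 = c := by simp [succinctWidth]
    rw [this]
    exact (Nat.div_le_self _ _).trans (by simp)
  · have hw : n ≤ succinctWidth c n := le_succinctWidth c n
    have h1 : 2 ^ succinctWidth c n / succinctWidth c n ^ (c + 1) ≤
        (2 ^ c * 2 ^ n * n ^ c) / (n ^ c * n) := by
      calc 2 ^ succinctWidth c n / succinctWidth c n ^ (c + 1)
          ≤ (2 ^ c * 2 ^ n * n ^ c) / succinctWidth c n ^ (c + 1) :=
            Nat.div_le_div_right (two_pow_succinctWidth_le hn)
        _ ≤ (2 ^ c * 2 ^ n * n ^ c) / n ^ (c + 1) :=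
            Nat.div_le_div_left (Nat.pow_le_pow_left hw _) (pow_pos hn _)
        _ = (2 ^ c * 2 ^ n * n ^ c) / (n ^ c * n) := by rw [pow_succ]
    have h2 : (2 ^ c * 2 ^ n * n ^ c) / (n ^ c * n) = (2 ^ c * 2 ^ n) / n := by
      rw [Nat.mul_comm (n ^ c) n]
      exact Nat.mul_div_mul_right _ _ (pow_pos hn c)
    have h3 : (2 ^ c * 2 ^ n) / n ≤ 2 ^ c * (2 ^ n / n) + 2 ^ c := by
      set C := 2 ^ c
      set a := 2 ^ n
      calc C * a / n = C * (n * (a / n) + a % n) / n := by rw [Nat.div_add_mod]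
        _ = (n * (C * (a / n)) + C * (a % n)) / n := by ring_nf
        _ = C * (a / n) + C * (a % n) / n := by rw [Nat.mul_add_div hn]
        _ ≤ C * (a / n) + C * n / n := by gcongr; exact (Nat.mod_lt a hn).le
        _ = C * (a / n) + C := by rw [Nat.mul_div_cancel _ hn]
    calc 2 ^ succinctWidth c n / succinctWidth c n ^ (c + 1)
        ≤ (2 ^ c * 2 ^ n * n ^ c) / (n ^ c * n) := h1
      _ = (2 ^ c * 2 ^ n) / n := h2
      _ ≤ 2 ^ c * (2 ^ n / n) + 2 ^ c := h3

/-- Hence an `O(2ʷ/w^{c+1})` bound at width `w = succinctWidth c n` is `O(williamsBound n)`: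
`a · (2ʷ/w^{c+1}) + a ≤ (a 2ᶜ) · williamsBound n + (a 2ᶜ + a)`. [folklore] -/
theorem satTime_le_williamsBound (a c n : ℕ) :
    a * (2 ^ succinctWidth c n / succinctWidth c n ^ (c + 1)) + a ≤
      a * 2 ^ c * williamsBound n + (a * 2 ^ c + a) := by
  have h := two_pow_succinctWidth_div_le c n
  have hw : 2 ^ n / n ≤ williamsBound n := Nat.le_add_left _ _
  calc a * (2 ^ succinctWidth c n / succinctWidth c n ^ (c + 1)) + a
      ≤ a * (2 ^ c * (2 ^ n / n) + 2 ^ c) + a := by gcongr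
    _ = a * 2 ^ c * (2 ^ n / n) + (a * 2 ^ c + a) := by ring
    _ ≤ a * 2 ^ c * williamsBound n + (a * 2 ^ c + a) := by gcongr

/-! ### Code lengths -/

namespace MachineB

/-- `|1ⁿ| = n` (Mathlib's `unary_decode_encode_nat`, `unaryDecodeNat = List.length`).
[folklore] -/
theorem length_unaryEncodeNat (n : ℕ) : (unaryEncodeNat n).length = n :=
  unary_decode_encode_nat n

/-- The nested-pair body of the list encoding has length `Σ (2|a| + 2)`. [folklore] -/
theorem length_foldr_boolPair (l : List (List Bool)) :
    (l.foldr (fun a acc => boolPair a acc) []).length = (l.map fun a => 2 * a.length + 2).sum := by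
  induction l with
  | nil => rfl
  | cons a l ih =>
    simp only [List.foldr_cons, length_boolPair, ih, List.map_cons, List.sum_cons]

/-- The list-of-naturals encoding, unfolded. [folklore] -/
theorem encode_listNat_eq (l : List ℕ) :
    encodingListNatBool.encode l =
      boolPair (unaryEncodeNat l.length) ((l.map encodeNat).foldr (fun a acc => boolPair a acc) []) := by
  show boolPair (unaryEncodeNat l.length) (l.foldr (fun a acc => boolPair (encodeNat a) acc) []) = _
  rw [List.foldr_map]

/-- **Length of the encoding of a list of naturals all `≤ B`**: at most `2 + |l| (2B + 6)`.
[folklore] -/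
theorem length_encode_listNat_le {l : List ℕ} {B : ℕ} (h : ∀ a ∈ l, a ≤ B) :
    (encodingListNatBool.encode l).length ≤ 2 + l.length * (2 * B + 6) := by
  rw [encode_listNat_eq, length_boolPair, length_unaryEncodeNat, length_foldr_boolPair,
    List.map_map]
  have hsum : ((l.map ((fun a : List Bool => 2 * a.length + 2) ∘ encodeNat))).sum ≤
      l.length * (2 * B + 4) := by
    have : ∀ a ∈ l, ((fun a : List Bool => 2 * a.length + 2) ∘ encodeNat) a ≤ 2 * B + 4 := by
      intro a ha
      have h1 := TM2Pass.length_encodeNat_le_self a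
      have h2 := h a ha
      simp only [Function.comp_apply]
      omega
    have h' := List.sum_le_card_nsmul (l.map ((fun a : List Bool => 2 * a.length + 2) ∘ encodeNat))
      (2 * B + 4) fun x hx => by
        obtain ⟨a, ha, rfl⟩ := List.mem_map.1 hx
        exact this a ha
    simpa using h'
  nlinarith [hsum]

/-- The list-of-lists encoding, unfolded. [folklore] -/
theorem encodeAccCircuitList_eq (m : ℕ) {n : ℕ} (Cs : List (Circuit (Fin n))) :
    encodeAccCircuitList m Cs =
      boolPair (unaryEncodeNat Cs.length)
        ((Cs.map (encodeAccCircuit m)).foldr (fun a acc => boolPair a acc) []) := by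
  show boolPair (unaryEncodeNat (Cs.map (circuitCodeList m)).length)
      ((Cs.map (circuitCodeList m)).foldr
        (fun a acc => boolPair (encodingListNatBool.encode a) acc) []) = _
  rw [List.length_map, List.foldr_map, List.foldr_map]
  rfl

/-- Symbolic gate codes are `≤ 4`. [folklore] -/
theorem accCode_le_four (m : ℕ) (f : GateFn) : accCode m f ≤ 4 := by
  unfold accCode; split_ifs <;> omega

/-- Every entry of the code of a circuit is at most `w + size + fan-in + 4`. [folklore] -/
theorem mem_circuitCodeList_le {w : ℕ} (m : ℕ) (C : Circuit (Fin w)) {a : ℕ}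
    (ha : a ∈ circuitCodeList m C) : a ≤ w + C.size + C.maxFanIn + 4 := by
  simp only [circuitCodeList, List.cons_append, List.mem_cons, List.mem_append,
    List.mem_flatMap] at ha
  rcases ha with rfl | hout | rfl | ⟨g, hg, ha⟩
  · omega
  · -- the output wire
    rcases hC : C.output with i | j
    · rw [hC, wireCode] at hout
      simp only [List.mem_cons, List.not_mem_nil, or_false] at hout
      rcases hout with rfl | h
      · omega
      · have := i.isLt; omega
    · rw [hC, wireCode] at hout
      simp only [List.mem_cons, List.not_mem_nil, or_false] at hout
      rcases hout with rfl | h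
      · omega
      · have := C.wf_output j hC; simp only [Circuit.size]; omega
  · simp only [Circuit.size]; omega
  · -- an entry of a gate code
    obtain ⟨j, hj, rfl⟩ := List.getElem_of_mem hg
    have harity : (C.gates[j]).arity ≤ C.maxFanIn := BT.arity_le_maxFanIn C (List.getElem_mem hj)
    simp only [gateCodeList, List.mem_cons, List.mem_flatMap, List.mem_ofFn] at ha
    rcases ha with rfl | rfl | ⟨wire, ⟨i, rfl⟩, hw⟩
    · have := accCode_le_four m (C.gates[j]).fn; omega
    · omega
    · rcases hC : (C.gates[j]).args i with v | m'
      · rw [hC, wireCode] at hw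
        simp only [List.mem_cons, List.not_mem_nil, or_false] at hw
        rcases hw with rfl | h
        · omega
        · have := v.isLt; omega
      · rw [hC, wireCode] at hw
        simp only [List.mem_cons, List.not_mem_nil, or_false] at hw
        rcases hw with rfl | h
        · omega
        · have h1 := C.wf j hj i m' hC
          simp only [Circuit.size]; omega

/-- The code of a circuit has `4 + Σ (2 + 2·arity)` entries, at most `4 + size (2 fan-in + 2)`.
[folklore] -/
theorem length_circuitCodeList_le {w : ℕ} (m : ℕ) (C : Circuit (Fin w)) :
    (circuitCodeList m C).length ≤ 4 + C.size * (2 * C.maxFanIn + 2) := by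
  simp only [circuitCodeList, List.cons_append, List.length_cons, List.length_append,
    length_wireCode, List.length_flatMap]
  have : ∀ g ∈ C.gates, (gateCodeList m g).length ≤ 2 * C.maxFanIn + 2 := by
    intro g hg
    have harity : g.arity ≤ C.maxFanIn := BT.arity_le_maxFanIn C hg
    simp only [gateCodeList, List.length_cons, List.length_flatMap, List.map_ofFn, List.sum_ofFn,
      Function.comp_def, length_wireCode, Finset.sum_const, Finset.card_univ, Fintype.card_fin,
      smul_eq_mul]
    omega
  have hsum := List.sum_le_card_nsmul (C.gates.map fun g => (gateCodeList m g).length)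
    (2 * C.maxFanIn + 2) fun x hx => by
      obtain ⟨g, hg, rfl⟩ := List.mem_map.1 hx
      exact this g hg
  simp only [List.length_map, smul_eq_mul] at hsum
  simp only [Circuit.size]
  omega

/-- The length bound `codeLen w s φ` for the string code of a circuit on `w` inputs with at most
`s` gates and fan-in at most `φ`. [folklore] -/
def codeLen (w s φ : ℕ) : ℕ := 2 + (4 + s * (2 * φ + 2)) * (2 * (w + s + φ) + 14)

/-- `codeLen` is monotone. [folklore] -/
theorem codeLen_mono {w w' s s' φ φ' : ℕ} (hw : w ≤ w') (hs : s ≤ s') (hφ : φ ≤ φ') :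
    codeLen w s φ ≤ codeLen w' s' φ' := by
  unfold codeLen; gcongr

/-- **The string code of a circuit has polynomial length**:
`|encodeAccCircuit m W| ≤ codeLen w size fan-in`. [folklore] -/
theorem length_encodeAccCircuit_le {w : ℕ} (m : ℕ) (W : Circuit (Fin w)) {s φ : ℕ}
    (hs : W.size ≤ s) (hφ : W.maxFanIn ≤ φ) : (encodeAccCircuit m W).length ≤ codeLen w s φ := by
  have h1 := length_encode_listNat_le (l := circuitCodeList m W) (B := w + s + φ + 4)
    fun a ha => (mem_circuitCodeList_le m W ha).trans (by omega)
  have h2 := length_circuitCodeList_le m W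
  have h3 : (circuitCodeList m W).length ≤ 4 + s * (2 * φ + 2) :=
    h2.trans (by gcongr)
  unfold encodeAccCircuit codeLen
  calc (encodingListNatBool.encode (circuitCodeList m W)).length
      ≤ 2 + (circuitCodeList m W).length * (2 * (w + s + φ + 4) + 6) := h1
    _ ≤ 2 + (4 + s * (2 * φ + 2)) * (2 * (w + s + φ + 4) + 6) := by gcongr
    _ = 2 + (4 + s * (2 * φ + 2)) * (2 * (w + s + φ) + 14) := by ring

/-- **The printout of a family of circuits has polynomial length**:
`|encodeAccCircuitList m Cs| ≤ 2 + |Cs| (2 codeLen + 4)`. [folklore] -/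
theorem length_encodeAccCircuitList_le {w : ℕ} (m : ℕ) (Cs : List (Circuit (Fin w))) {s φ : ℕ}
    (hs : ∀ C ∈ Cs, C.size ≤ s) (hφ : ∀ C ∈ Cs, C.maxFanIn ≤ φ) :
    (encodeAccCircuitList m Cs).length ≤ 2 + Cs.length * (2 * codeLen w s φ + 4) := by
  rw [encodeAccCircuitList_eq, length_boolPair, length_unaryEncodeNat, length_foldr_boolPair,
    List.map_map]
  have : ∀ C ∈ Cs, ((fun a : List Bool => 2 * a.length + 2) ∘ encodeAccCircuit m) C ≤
      2 * codeLen w s φ + 2 := by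
    intro C hC
    have := length_encodeAccCircuit_le m C (hs C hC) (hφ C hC)
    simp only [Function.comp_apply]
    omega
  have hsum := List.sum_le_card_nsmul
    (Cs.map ((fun a : List Bool => 2 * a.length + 2) ∘ encodeAccCircuit m))
    (2 * codeLen w s φ + 2) fun x hx => by
      obtain ⟨C, hC, rfl⟩ := List.mem_map.1 hx
      exact this C hC
  simp only [List.length_map, smul_eq_mul] at hsum
  nlinarith [hsum]

/-! ### The printout determines the clause circuits -/

/-- `encodeAccCircuitList m` is injective on lists of circuits over `accBasis m`. [folklore] -/
theorem encodeAccCircuitList_injOn (m : ℕ) {w : ℕ} :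
    ∀ Cs Cs' : List (Circuit (Fin w)), (∀ C ∈ Cs, C.IsOver (accBasis m)) →
      (∀ C ∈ Cs', C.IsOver (accBasis m)) →
        encodeAccCircuitList m Cs = encodeAccCircuitList m Cs' → Cs = Cs' := by
  intro Cs Cs' h h' heq
  have hmap : Cs.map (circuitCodeList m) = Cs'.map (circuitCodeList m) :=
    (encodingNatBool.listBool).listBool.encode_injective heq
  induction Cs generalizing Cs' with
  | nil => simpa using hmap.symm
  | cons C Cs ih =>
    cases Cs' with
    | nil => simp at hmap
    | cons C' Cs' =>
      simp only [List.map_cons, List.cons.injEq] at hmap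
      have hC : C = C' := circuitCodeList_injOn m w (h C (by simp)) (h' C' (by simp)) hmap.1
      subst hC
      rw [ih Cs' (fun D hD => h D (by simp [hD])) (fun D hD => h' D (by simp [hD]))
        (by rw [encodeAccCircuitList, encodeAccCircuitList, hmap.2]) hmap.2]

/-- **The printout of the generator determines the clause circuits**: two families over
`accBasis m` with the same printout along `clauseCoordList` are equal. [folklore] -/
theorem clauseCircuits_eq_of_encode_eq {m w : ℕ} {G G' : ClauseCoord w → Circuit (Fin w)}
    (hG : ∀ κ, (G κ).IsOver (accBasis m)) (hG' : ∀ κ, (G' κ).IsOver (accBasis m))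
    (h : encodeAccCircuitList m ((clauseCoordList w).map G) =
      encodeAccCircuitList m ((clauseCoordList w).map G')) : G = G' := by
  have hl := encodeAccCircuitList_injOn m _ _
    (fun C hC => by obtain ⟨κ, -, rfl⟩ := List.mem_map.1 hC; exact hG κ)
    (fun C hC => by obtain ⟨κ, -, rfl⟩ := List.mem_map.1 hC; exact hG' κ) h
  funext κ
  have hκ := mem_clauseCoordList κ
  obtain ⟨i, hi, rfl⟩ := List.getElem_of_mem hκ
  have := congrArg (fun l => l[i]?) hl
  simpa [List.getElem?_map, List.getElem?_eq_getElem hi] using this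

end MachineB

/-! ### Affine bounds `a ≤ K · T + K` -/

namespace MachineB

/-- `LeAff a K T`: `a ≤ K · T + K` (the arithmetic `O(T)` of the tree's time classes).
[folklore] -/
def LeAff (a K T : ℕ) : Prop := a ≤ K * T + K

/-- Unfolding. [folklore] -/
theorem LeAff.le {a K T : ℕ} (h : LeAff a K T) : a ≤ K * T + K := h

/-- Smaller quantities inherit the bound. [folklore] -/
theorem LeAff.of_le {a b K T : ℕ} (h : LeAff b K T) (hab : a ≤ b) : LeAff a K T :=
  hab.trans h

/-- Larger constants. [folklore] -/
theorem LeAff.mono {a K K' T : ℕ} (h : LeAff a K T) (hK : K ≤ K') : LeAff a K' T :=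
  h.le.trans (by unfold LeAff at *; nlinarith)

/-- Sums. [folklore] -/
theorem LeAff.add {a b K₁ K₂ T : ℕ} (h₁ : LeAff a K₁ T) (h₂ : LeAff b K₂ T) :
    LeAff (a + b) (K₁ + K₂) T := by
  unfold LeAff at *; nlinarith

/-- Constants. [folklore] -/
theorem LeAff.const (k T : ℕ) : LeAff k k T := by unfold LeAff; nlinarith

/-- `T` itself. [folklore] -/
theorem LeAff.self (T : ℕ) : LeAff T 1 T := by unfold LeAff; omega

/-- Constant multiples. [folklore] -/
theorem LeAff.mul {a K T : ℕ} (h : LeAff a K T) (k : ℕ) : LeAff (k * a) (k * K) T := by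
  unfold LeAff at *; nlinarith

end MachineB

/-! ### The stages of `B`: specifications -/

/-- The length guard of stage 1: keep `r` if it is no longer than the yardstick `q`, else cut
it to `ε`. [folklore] -/
def guardLen (q : ℕ) (r : List Bool) : List Bool := if r.length ≤ q then r else []

/-- A short `r` passes the guard. [folklore] -/
@[simp] theorem guardLen_of_le {q : ℕ} {r : List Bool} (h : r.length ≤ q) : guardLen q r = r := by
  simp [guardLen, h]

/-- The guarded word is no longer than the yardstick. [folklore] -/
theorem length_guardLen_le (q : ℕ) (r : List Bool) : (guardLen q r).length ≤ q := by
  unfold guardLen; split_ifs with h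
  · exact h
  · exact Nat.zero_le _

/-- The guard does not lengthen. [folklore] -/
theorem length_guardLen_le_self (q : ℕ) (r : List Bool) : (guardLen q r).length ≤ r.length := by
  unfold guardLen; split_ifs <;> simp

/-- The token of stage 3: `⟨1 out, g⟩ ↦ 1 ⟨out, g⟩`, anything else `↦ 00`. [folklore] -/
def okToken : List Bool → List Bool → List Bool
  | true :: out, r => true :: boolPair out r
  | _, _ => [false, false]

/-- The accepting token. [folklore] -/
@[simp] theorem okToken_true_cons (out r : List Bool) :
    okToken (true :: out) r = true :: boolPair out r := rfl

/-- The rejecting token. [folklore] -/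
@[simp] theorem okToken_false_cons (out r : List Bool) : okToken (false :: out) r = [false, false] := rfl

/-- The rejecting token (empty flag word). [folklore] -/
@[simp] theorem okToken_nil (r : List Bool) : okToken [] r = [false, false] := rfl

/-- Length of the token. [folklore] -/
theorem length_okToken_le (v r : List Bool) : (okToken v r).length ≤ 2 * v.length + r.length + 3 := by
  rcases v with _ | ⟨_ | _, out⟩
  · simp [okToken]
  · simp [okToken]
  · simp only [okToken, List.length_cons, length_boolPair]; omega

/-- The size bound of admissible witness circuits at exponent `e` and width `w`: the honest
witness has `≤ nᵉ + e` gates, padding to `w` inputs adds `w + 2` (`Circuit.exists_padInputs`).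
[folklore] -/
def wSize (e w : ℕ) : ℕ := w ^ e + e + w + 2

/-- `wSize e` is monotone in the width. [folklore] -/
theorem wSize_mono {e w w' : ℕ} (h : w ≤ w') : wSize e w ≤ wSize e w' := by
  unfold wSize; gcongr

/-- **Stage 1** (re-association with a length guard): on `⟨⟨x, u⟩, z⟩` the machine outputs
`⟨⟨x, z₁⟩, guardLen |u| z₂⟩`, `(z₁, z₂) = boolUnpair z`, in linear time. [folklore] -/
def ReassocMachine (P : TM2ComputableAux Bool Bool) (C : ℕ) : Prop :=
  ∀ x u z : List Bool, P.OutputsWithin (boolPair (boolPair x u) z)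
    (boolPair (boolPair x (boolUnpair z).1) (guardLen u.length (boolUnpair z).2))
    (C * (boolPair (boolPair x u) z).length + C)

/-- **Stage 3** (dispatch on the generator's flag): on `⟨v, r⟩` the machine outputs
`okToken v r` in linear time. [folklore] -/
def OkDispatchMachine (P : TM2ComputableAux Bool Bool) (C : ℕ) : Prop :=
  ∀ v r : List Bool, P.OutputsWithin (boolPair v r) (okToken v r) (C * (boolPair v r).length + C)

/-- **Stage `F`** (the code of the SAT instance `D`), as a specification of a string function `F`
at modulus `m`, depth bound `dW` and size exponent `e`: `F 00 = 00`; on `1 ⟨out, r⟩` with `out`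
the printout of a family `G` of circuits over `accBasis m` along `clauseCoordList w`, `F`
answers either `00` or `1 (code of the witness-check circuit WitnessCheck.circuit G W)` for some
circuit `W` on `w` inputs over `accBasis m` with `acDepth ≤ dW`, `size ≤ wSize e w` and fan-in at
most `|r|` (soundness); and if `r` is the code of such a `W`, the answer is the latter for this
`W` (completeness). The instance is NOT fan-in–normalised (`Williams2014SatInstance.lean` also
offers the normalised `satInstance`): the fan-in of the guessed `W` is bounded by the length of
its code, which stage 1 has cut at the polynomial yardstick, and the honest witness is
normalised before it is encoded (`accept_iff`). [folklore] -/
def SatInstanceFn.Spec (m dW e : ℕ) (F : List Bool → List Bool) : Prop :=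
  F [false, false] = [false, false] ∧
  ∀ (w : ℕ) (G : ClauseCoord w → Circuit (Fin w)), (∀ κ, (G κ).IsOver (accBasis m)) →
    (∀ r : List Bool,
      F (true :: boolPair (encodeAccCircuitList m ((clauseCoordList w).map G)) r) = [false, false] ∨
      ∃ W : Circuit (Fin w), W.IsOver (accBasis m) ∧ W.acDepth ≤ dW ∧ W.size ≤ wSize e w ∧
        W.maxFanIn ≤ r.length ∧
        F (true :: boolPair (encodeAccCircuitList m ((clauseCoordList w).map G)) r) =
          true :: encodeAccCircuit m (WitnessCheck.circuit G W)) ∧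
    (∀ W : Circuit (Fin w), W.IsOver (accBasis m) → W.acDepth ≤ dW → W.size ≤ wSize e w →
      F (true :: boolPair (encodeAccCircuitList m ((clauseCoordList w).map G))
        (encodeAccCircuit m W)) = true :: encodeAccCircuit m (WitnessCheck.circuit G W))

/-! ### The witness-check circuit without fan-in normalisation -/

namespace MachineB

open WitnessCheck GateList

section Arity

variable {ι κ : Type*}

/-- Arity bounds survive juxtaposition. [folklore] -/
theorem forall_arity_parBlocks {K : ℕ} : ∀ bs : List (List (Gate ι) × (ι ⊕ ℕ)),
    (∀ b ∈ bs, ∀ g ∈ b.1, g.arity ≤ K) → ∀ g ∈ (parBlocks bs).1, g.arity ≤ K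
  | [], _, g, hg => by simp [parBlocks] at hg
  | (gs, o) :: rest, h, g, hg => by
    simp only [parBlocks, List.mem_append, List.mem_map] at hg
    rcases hg with hg | ⟨g', hg', rfl⟩
    · exact h (gs, o) (by simp) g hg
    · exact forall_arity_parBlocks rest (fun b hb => h b (by simp [hb])) g' hg'

/-- Arity bounds survive a plug. [folklore] -/
theorem forall_arity_plug {K : ℕ} {gs : List (Gate ι)} (h : ∀ g ∈ gs, g.arity ≤ K) (ρ : κ → ι ⊕ ℕ)
    {A : Circuit κ} (hA : A.maxFanIn ≤ K) : ∀ g ∈ (plug gs ρ A).1, g.arity ≤ K := by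
  intro g hg
  rw [plug_fst, List.mem_append, List.mem_map] at hg
  rcases hg with hg | ⟨g', hg', rfl⟩
  · exact h g hg
  · exact (BT.arity_le_maxFanIn A hg').trans hA

/-- Arity bounds survive appending one small gate. [folklore] -/
theorem forall_arity_snoc {K : ℕ} {gs : List (Gate ι)} (h : ∀ g ∈ gs, g.arity ≤ K) {g' : Gate ι}
    (hg' : g'.arity ≤ K) : ∀ g ∈ gs ++ [g'], g.arity ≤ K := by
  intro g hg
  rw [List.mem_append, List.mem_singleton] at hg
  rcases hg with hg | rfl
  · exact h g hg
  · exact hg'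

/-- Arity bounds survive the slot test (`K ≥ 3`). [folklore] -/
theorem forall_arity_addSlot {K : ℕ} (hK : 3 ≤ K) {gs : List (Gate ι)} (h : ∀ g ∈ gs, g.arity ≤ K)
    (a s' p : ι ⊕ ℕ) : ∀ g ∈ (addSlot gs a s' p).1, g.arity ≤ K := by
  simp only [addSlot, andWire, orWire, notWire]
  refine forall_arity_snoc (forall_arity_snoc (forall_arity_snoc (forall_arity_snoc (forall_arity_snoc
    (forall_arity_snoc h ?_) ?_) ?_) ?_) ?_) ?_
  all_goals simp only [bigGate, notGate]; omega

end Arity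

/-- **The gates of the witness-check program have arity `≤ max (fan-in of the G κ) (fan-in of W) 3`.**
[folklore] -/
theorem arity_le_st8 {w : ℕ} (G : ClauseCoord w → Circuit (Fin w)) (W : Circuit (Fin w)) {fG fW : ℕ}
    (hG : ∀ κ, (G κ).maxFanIn ≤ fG) (hW : W.maxFanIn ≤ fW) :
    ∀ g ∈ (st8 G W).1, g.arity ≤ max fG (max fW 3) := by
  set K := max fG (max fW 3) with hK
  have hK3 : 3 ≤ K := by rw [hK]; omega
  have hWK : W.maxFanIn ≤ K := hW.trans (by rw [hK]; omega)
  have h0 : ∀ g ∈ (stG G).1, g.arity ≤ K := forall_arity_parBlocks _ fun b hb g hg => by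
    obtain ⟨C, hC, rfl⟩ := List.mem_map.1 hb
    obtain ⟨k, rfl⟩ := List.mem_ofFn.1 hC
    exact (BT.arity_le_maxFanIn _ hg).trans ((hG _).trans (by rw [hK]; omega))
  have h3 : ∀ g ∈ (st3 G W).1, g.arity ≤ K :=
    forall_arity_plug (forall_arity_plug (forall_arity_plug h0 _ hWK) _ hWK) _ hWK
  have h6 : ∀ g ∈ (st6 G W).1, g.arity ≤ K :=
    forall_arity_addSlot hK3 (forall_arity_addSlot hK3 (forall_arity_addSlot hK3 h3 _ _ _) _ _ _) _ _ _
  have h7 : ∀ g ∈ (st7 G W).1, g.arity ≤ K := by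
    simp only [st7, or₃Wire]
    exact forall_arity_snoc h6 (by simp only [bigGate]; omega)
  simp only [st8, notWire]
  exact forall_arity_snoc h7 (by simp only [notGate]; omega)

/-- **Specification of the witness-check circuit `WitnessCheck.circuit G W`** (the instance `D`
without fan-in normalisation; cf. `satInstance_spec`): over `accBasis m`, `acDepth ≤ d_W + d_G + 4`,
at most `3 (w + 2) s_G + 3 s_W + 20` gates, fan-in at most `max f_G (max (fan-in of W) 3)`, value
`¬ clause-check`, and UNSATISFIABLE iff `W` encodes a satisfying assignment of `succinctCNF c cl x`.
[cite: Williams2014, proof of Thm. 3.2 (pp. 12–13)] -/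
theorem circuit_spec {c m : ℕ} {L : Language Bool} {cl : List Bool → ℕ → Clause ℕ}
    (hred : IsSuccinctReduction c L cl) (x : List Bool) {dG sG fG dW sW : ℕ}
    (G : ClauseCoord (succinctWidth c x.length) → Circuit (Fin (succinctWidth c x.length)))
    (hGB : ∀ κ, (G κ).IsOver (accBasis m)) (hGd : ∀ κ, (G κ).acDepth ≤ dG)
    (hGs : ∀ κ, (G κ).size ≤ sG) (hGf : ∀ κ, (G κ).maxFanIn ≤ fG)
    (hGe : ∀ κ i, (G κ).eval i = clauseMap (succinctWidth c x.length) (cl x) i κ)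
    (W : Circuit (Fin (succinctWidth c x.length))) (hWB : W.IsOver (accBasis m))
    (hWd : W.acDepth ≤ dW) (hWs : W.size ≤ sW) :
    (circuit G W).IsOver (accBasis m) ∧
    (circuit G W).acDepth ≤ dW + dG + 4 ∧
    (circuit G W).size ≤ 3 * (succinctWidth c x.length + 2) * sG + 3 * sW + 20 ∧
    (circuit G W).maxFanIn ≤ max fG (max W.maxFanIn 3) ∧
    (∀ i, (circuit G W).eval i = !(Clause.eval W.assignment (cl x (bitsVal i)))) ∧
    (¬ (circuit G W).Satisfiable ↔ (succinctCNF c cl x).eval W.assignment = true) := by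
  have hev : ∀ i, (circuit G W).eval i = !(Clause.eval W.assignment (cl x (bitsVal i))) := by
    intro i
    rw [circuit_eval_eq]
    have hGi : (fun κ => (G κ).eval i) = clauseMap (succinctWidth c x.length) (cl x) i :=
      funext fun κ => hGe κ i
    rw [hGi, clauseMap, clauseCheck_clauseBit W (hred.length_le x _) (hred.var_lt x _)]
  refine ⟨circuit_isOver G W (acBasis_subset_accBasis m) hGB hWB, circuit_acDepth_le G W hGd hWd, ?_, ?_,
    hev, ?_⟩
  · rw [circuit_size]
    have h1 : (∑ k : Fin (3 * (succinctWidth c x.length + 2)), (G (coordOf k)).size) ≤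
        3 * (succinctWidth c x.length + 2) * sG := by
      refine (Finset.sum_le_card_nsmul _ _ sG fun k _ => hGs _).trans ?_
      simp
    have h2 : 3 * W.size ≤ 3 * sW := Nat.mul_le_mul_left 3 hWs
    omega
  · have hg : (circuit G W).gates = (st8 G W).1 := rfl
    exact Circuit.maxFanIn_le_of_forall _ fun g hg' => arity_le_st8 G W hGf le_rfl g (hg ▸ hg')
  · constructor
    · intro h
      rw [eval_succinctCNF_eq_true_iff]
      intro v hv
      by_contra hne
      refine h ⟨(MetaComplexity.boolFunEquivFin _).symm ⟨v, hv⟩, ?_⟩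
      rw [hev, bitsVal_symm_apply hv]
      simpa using hne
    · rintro h ⟨i, hi⟩
      rw [eval_succinctCNF_eq_true_iff] at h
      rw [hev, h _ (bitsVal_lt i)] at hi
      simp at hi

end MachineB

/-! ### The acceptance relation of `B` -/

namespace MachineB

open WitnessCheck

/-- **The acceptance relation of `B`** on input `x` and (truncated) certificate `z = ⟨z₁, z₂⟩`:
the generator accepts `⟨x, z₁⟩`, printing the clause circuits `G`; the stage `F` answers with
the code of the witness-check circuit `circuit G W` for an admissible `W`; and that instance is
unsatisfiable.
(Classical; it is the Boolean the machine computes, `core_outputsWithin`.) [cite: Williams2014, proof of Thm. 3.2 (pp. 12–13)] -/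
noncomputable def accept (F : List Bool → List Bool) (ok : List Bool → List Bool → Bool)
    (out : List Bool → List Bool → List Bool) (m c dW e : ℕ) (q : ℕ → ℕ) (x z : List Bool) : Bool :=
  @decide (∃ (G : ClauseCoord (succinctWidth c x.length) → Circuit (Fin (succinctWidth c x.length)))
      (W : Circuit (Fin (succinctWidth c x.length))),
    ok x (boolUnpair z).1 = true ∧ (∀ κ, (G κ).IsOver (accBasis m)) ∧
    out x (boolUnpair z).1 =
      encodeAccCircuitList m ((clauseCoordList (succinctWidth c x.length)).map G) ∧
    W.IsOver (accBasis m) ∧ W.acDepth ≤ dW ∧ W.size ≤ wSize e (succinctWidth c x.length) ∧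
    F (true :: boolPair (out x (boolUnpair z).1) (guardLen (q x.length) (boolUnpair z).2)) =
      true :: encodeAccCircuit m (circuit G W) ∧
    ¬ (circuit G W).Satisfiable) (Classical.dec _)

/-- `accept = true` unfolded. [folklore] -/
theorem accept_eq_true_iff {F : List Bool → List Bool} {ok : List Bool → List Bool → Bool}
    {out : List Bool → List Bool → List Bool} {m c dW e : ℕ} {q : ℕ → ℕ} {x z : List Bool} :
    accept F ok out m c dW e q x z = true ↔
      ∃ (G : ClauseCoord (succinctWidth c x.length) → Circuit (Fin (succinctWidth c x.length)))
        (W : Circuit (Fin (succinctWidth c x.length))),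
      ok x (boolUnpair z).1 = true ∧ (∀ κ, (G κ).IsOver (accBasis m)) ∧
      out x (boolUnpair z).1 =
        encodeAccCircuitList m ((clauseCoordList (succinctWidth c x.length)).map G) ∧
      W.IsOver (accBasis m) ∧ W.acDepth ≤ dW ∧ W.size ≤ wSize e (succinctWidth c x.length) ∧
      F (true :: boolPair (out x (boolUnpair z).1) (guardLen (q x.length) (boolUnpair z).2)) =
        true :: encodeAccCircuit m (circuit G W) ∧
      ¬ (circuit G W).Satisfiable := by
  unfold accept
  exact @decide_eq_true_iff _ (Classical.dec _)

/-- **Correctness of `B`** (Williams 2014, p. 13: "if `x ∈ L` then some computation path of `B`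
accepts; if `x ∉ L` then no `W` encodes a satisfying assignment and every `D` is
satisfiable"): with a yardstick `q` dominating the code length of admissible witnesses and a
certificate length `s x ≥ 2 (c_A t(n) + c_A) + 2 + q n`,
`x ∈ L ↔ ∃ z, |z| ≤ s x ∧ accept x z`. Completeness pads the succinct `ACC` witness to `w`
inputs (`Circuit.exists_padInputs`) and normalises its fan-in (`Circuit.normFanIn`); soundness
is `circuit_spec` and `IsSuccinctReduction.mem_iff`. [cite: Williams2014, proof of Thm. 3.2 (pp. 12–13)] -/
theorem accept_iff {c m dG eG dW eW cA : ℕ} {L : Language Bool} {cl : List Bool → ℕ → Clause ℕ}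
    (hred : IsSuccinctReduction c L cl) (hm : 0 < m)
    {ok : List Bool → List Bool → Bool} {out : List Bool → List Bool → List Bool}
    (hsound : ∀ x y, ok x y = true → GoodClauseCircuits c cl m dG eG x (out x y))
    (hcompl : ∀ x, ∃ y, y.length ≤ cA * williamsBound x.length + cA ∧ ok x y = true)
    (hWit : ∀ x ∈ L, ∃ (k : ℕ) (W : Circuit (Fin k)), k ≤ succinctWidth c x.length ∧
      W.IsOver (accBasis m) ∧ W.acDepth ≤ dW ∧ W.size ≤ x.length ^ eW + eW ∧
      (succinctCNF c cl x).eval W.assignment = true)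
    {F : List Bool → List Bool} (hF : SatInstanceFn.Spec m (dW + 3) eW F)
    (q : ℕ → ℕ) (hq : ∀ n, codeLen (succinctWidth c n) (wSize eW (succinctWidth c n))
      (m * (succinctWidth c n + wSize eW (succinctWidth c n))) ≤ q n)
    (s : List Bool → ℕ) (hs : ∀ x, 2 * (cA * williamsBound x.length + cA) + 2 + q x.length ≤ s x)
    (x : List Bool) :
    x ∈ L ↔ ∃ z, z.length ≤ s x ∧ accept F ok out m c (dW + 3) eW q x z = true := by
  constructor
  · intro hx
    obtain ⟨yA, hyA, hok⟩ := hcompl x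
    obtain ⟨k, W₀, hk, hB₀, hd₀, hs₀, hsat₀⟩ := hWit x hx
    obtain ⟨W₁, hB₁, hd₁, hs₁, hassign⟩ :=
      Circuit.exists_padInputs (w := succinctWidth c x.length) (acBasis_subset_accBasis m) hk W₀ hB₀
    have hnw : x.length ≤ succinctWidth c x.length := le_succinctWidth c x.length
    have hpow : x.length ^ eW ≤ succinctWidth c x.length ^ eW := Nat.pow_le_pow_left hnw _
    obtain ⟨W₂, hW₂⟩ : ∃ W₂ : Circuit (Fin (succinctWidth c x.length)), W₂ = W₁.normFanIn m :=
      ⟨_, rfl⟩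
    have hB₂ : W₂.IsOver (accBasis m) := hW₂ ▸ Circuit.isOver_normFanIn hB₁
    have hd₂ : W₂.acDepth ≤ dW + 3 := by
      rw [hW₂]
      exact (Circuit.acDepth_normFanIn_le m W₁).trans (by omega)
    have hs₂ : W₂.size ≤ wSize eW (succinctWidth c x.length) := by
      rw [hW₂, Circuit.size_normFanIn]
      refine hs₁.trans ?_
      unfold wSize
      omega
    have hφ₂ : W₂.maxFanIn ≤
        m * (succinctWidth c x.length + wSize eW (succinctWidth c x.length)) := by
      rw [hW₂]
      refine (Circuit.maxFanIn_normFanIn_le hm hB₁).trans (Nat.mul_le_mul_left m ?_)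
      refine Nat.add_le_add_left (hs₁.trans ?_) _
      unfold wSize
      omega
    have hassign₂ : W₂.assignment = W₀.assignment := by
      rw [← hassign, hW₂]
      exact Circuit.assignment_congr fun i => Circuit.eval_normFanIn m W₁ i
    have hlen : (encodeAccCircuit m W₂).length ≤ q x.length :=
      (length_encodeAccCircuit_le m W₂ hs₂ hφ₂).trans (hq x.length)
    refine ⟨boolPair yA (encodeAccCircuit m W₂), ?_, ?_⟩
    · rw [length_boolPair]
      have := hs x
      omega
    · obtain ⟨G, hG, hout⟩ := hsound x yA hok
      rw [accept_eq_true_iff]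
      simp only [boolUnpair_boolPair]
      rw [guardLen_of_le hlen]
      refine ⟨G, W₂, hok, fun κ => (hG κ).1, hout, hB₂, hd₂, hs₂, ?_, ?_⟩
      · rw [hout]
        exact (hF.2 _ G fun κ => (hG κ).1).2 W₂ hB₂ hd₂ hs₂
      · have hspec := circuit_spec hred x G (fun κ => (hG κ).1) (fun κ => (hG κ).2.1)
          (fun κ => (hG κ).2.2.1) (fun κ => (hG κ).2.2.2.1) (fun κ => (hG κ).2.2.2.2) W₂ hB₂ hd₂ hs₂
        rw [hspec.2.2.2.2.2, hassign₂]
        exact hsat₀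
  · rintro ⟨z, -, hacc⟩
    rw [accept_eq_true_iff] at hacc
    obtain ⟨G, W, hok, hGo, hout, hWB, hWd, hWs, -, hunsat⟩ := hacc
    obtain ⟨G', hG', hout'⟩ := hsound x _ hok
    have hGG : G' = G :=
      clauseCircuits_eq_of_encode_eq (fun κ => (hG' κ).1) hGo (hout'.symm.trans hout)
    subst hGG
    have hspec := circuit_spec hred x G' (fun κ => (hG' κ).1) (fun κ => (hG' κ).2.1)
      (fun κ => (hG' κ).2.2.1) (fun κ => (hG' κ).2.2.2.1) (fun κ => (hG' κ).2.2.2.2) W hWB hWd hWs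
    exact (hred.mem_iff x).2 ⟨W.assignment, hspec.2.2.2.2.2.1 hunsat⟩

end MachineB

/-! ### The core machine of `B` and its output -/

namespace MachineB

open WitnessCheck TM2Comp

/-- Bound on the length of the generator's accepted printout at input length `n`:
`3 (w + 2)` circuits of size and fan-in `≤ wᵉ + e` (`length_encodeAccCircuitList_le`). [folklore] -/
def outLenB (c eG n : ℕ) : ℕ :=
  2 + 3 * (succinctWidth c n + 2) *
    (2 * codeLen (succinctWidth c n) (succinctWidth c n ^ eG + eG) (succinctWidth c n ^ eG + eG) + 4)

/-- Bound on the length of the input `1 ⟨out, g⟩` of stage `F` (`|g| ≤ q n`). [folklore] -/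
def fInLenB (c eG n qn : ℕ) : ℕ := 3 + 2 * outLenB c eG n + qn

/-- The size bound of the SAT instance `D` at width `w`. [folklore] -/
def dSizeB (eG eW w : ℕ) : ℕ := 3 * (w + 2) * (w ^ eG + eG) + 3 * wSize eW w + 20

/-- **The running time of the core machine** on `⟨⟨x, 1^{q n}⟩, z⟩`, `|z| ≤ Z`, as a function
of `n = |x|` and `Z`: stage 1, the generator behind `mapFstAux`, stage 3, stage `F`, the SAT
call with its two wrappers. [folklore] -/
noncomputable def coreTime (C₁ C₃ cA DA cS c eG : ℕ) (pF : Polynomial ℕ) (q : ℕ → ℕ) (n Z : ℕ) : ℕ :=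
  (C₁ * (4 * n + 6 + 2 * q n + Z) + C₁) +
  ((cA * (williamsBound n + Z) + cA) +
    3 * (2 * n + 2 + Z + DA * (cA * (williamsBound n + Z) + cA)) + 2 * (4 * n + 6 + 2 * Z + q n) + 6) +
  (C₃ * (2 * (2 * n + 2 + Z + DA * (cA * (williamsBound n + Z) + cA)) + 2 + q n) + C₃) +
  pF.eval (fInLenB c eG n (q n)) +
  (cS * (2 ^ succinctWidth c n / succinctWidth c n ^ (c + 1)) + cS + 3)

/-- The accepted printout is short. [folklore] -/
theorem length_out_le {c m dG eG : ℕ} {cl : List Bool → ℕ → Clause ℕ} {x z : List Bool}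
    (h : GoodClauseCircuits c cl m dG eG x z) : z.length ≤ outLenB c eG x.length := by
  obtain ⟨G, hG, rfl⟩ := h
  have hnw : x.length ≤ succinctWidth c x.length := le_succinctWidth c x.length
  have hpow : x.length ^ eG ≤ succinctWidth c x.length ^ eG := Nat.pow_le_pow_left hnw _
  refine (length_encodeAccCircuitList_le m _ (s := succinctWidth c x.length ^ eG + eG)
    (φ := succinctWidth c x.length ^ eG + eG) ?_ ?_).trans ?_
  · intro C hC
    obtain ⟨κ, -, rfl⟩ := List.mem_map.1 hC
    exact (hG κ).2.2.1.trans (by omega)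
  · intro C hC
    obtain ⟨κ, -, rfl⟩ := List.mem_map.1 hC
    exact (hG κ).2.2.2.1.trans (by omega)
  · rw [List.length_map, length_clauseCoordList, outLenB]

/-- **The output of the core machine `P₁ ▸ mapFstAux A ▸ P₃ ▸ M_F ▸ compl (flagAux M_SAT)`** on
`⟨⟨x, 1^{q n}⟩, z⟩`: the bit `accept x z`, within `coreTime … n |z|` steps. The SAT machine is only
ever started on the code of an instance `circuit G W` with `G` the (good) clause circuits and `W`
admissible (fan-in at most the yardstick `q n`), which lies in the class on which it is specified
(`circuit_spec`, exponent `eD` from `heD`); a rejected generator run or an unparsable witness is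
answered without it.
[cite: Williams2014, proof of Thm. 3.2 (pp. 12–13)] -/
theorem core_outputsWithin {c m dG eG dW eW cA C₁ C₃ cS eD : ℕ} {L : Language Bool}
    {cl : List Bool → ℕ → Clause ℕ} (hred : IsSuccinctReduction c L cl)
    {P₁ P₃ A MF MS : TM2ComputableAux Bool Bool}
    (hP₁ : ReassocMachine P₁ C₁) (hP₃ : OkDispatchMachine P₃ C₃)
    {ok : List Bool → List Bool → Bool} {out : List Bool → List Bool → List Bool}
    (hA : ∀ x y, A.OutputsWithin (boolPair x y) (ok x y :: out x y)
      (cA * (williamsBound x.length + y.length) + cA))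
    (hsound : ∀ x y, ok x y = true → GoodClauseCircuits c cl m dG eG x (out x y))
    {F : List Bool → List Bool} {pF : Polynomial ℕ}
    (hMF : ∀ a, MF.OutputsWithin a (F a) (pF.eval a.length))
    (hF : SatInstanceFn.Spec m (dW + 3) eW F)
    (hMS : ∀ (n : ℕ) (C : Circuit (Fin n)), C.IsOver (accBasis m) → C.acDepth ≤ dW + 3 + dG + 4 →
      C.size ≤ n ^ eD + eD → C.maxFanIn ≤ n ^ eD + eD →
        MS.OutputsWithin (encodeAccCircuit m C) (encodeBool (decide C.Satisfiable))
          (cS * (2 ^ n / n ^ (c + 1)) + cS))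
    (q : ℕ → ℕ)
    (heD : ∀ n, dSizeB eG eW (succinctWidth c n) ≤ succinctWidth c n ^ eD + eD ∧
      succinctWidth c n ^ eG + eG + q n + 3 ≤ succinctWidth c n ^ eD + eD)
    (x z : List Bool) :
    (P₁.comp ((mapFstAux A).comp (P₃.comp (MF.comp (complMachine (flagAux MS fun _ => [true])))))).OutputsWithin
      (boolPair (boolPair x (ones (q x.length))) z)
      [accept F ok out m c (dW + 3) eW q x z]
      (coreTime C₁ C₃ cA (machinePushBound A.tm) cS c eG pF q x.length z.length) := by
  -- names
  set yA := (boolUnpair z).1 with hyA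
  set g := guardLen (q x.length) (boolUnpair z).2 with hg
  set v := ok x yA :: out x yA with hv
  have hzparts := length_boolUnpair_parts_le z
  have hyAZ : yA.length ≤ z.length := by rw [hyA]; omega
  have hgq : g.length ≤ q x.length := length_guardLen_le _ _
  have hgZ : g.length ≤ z.length := (length_guardLen_le_self _ _).trans (by omega)
  have hnw : x.length ≤ succinctWidth c x.length := le_succinctWidth c x.length
  have hpow : x.length ^ eG ≤ succinctWidth c x.length ^ eG := Nat.pow_le_pow_left hnw _
  -- stage 1
  have h1 : P₁.OutputsWithin (boolPair (boolPair x (ones (q x.length))) z) (boolPair (boolPair x yA) g)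
      (C₁ * (boolPair (boolPair x (ones (q x.length))) z).length + C₁) := by
    have := hP₁ x (ones (q x.length)) z
    simpa [List.length_replicate, ← hyA, ← hg] using this
  -- stage 2: the generator behind `mapFstAux`
  have hAv : A.OutputsWithin (boolUnpair (boolPair (boolPair x yA) g)).1 v
      (cA * (williamsBound x.length + yA.length) + cA) := by
    rw [boolUnpair_boolPair]; exact hA x yA
  have h2 := outputsWithin_mapFstAux A hAv
  rw [readRest_boolPair] at h2
  have hvlen : v.length ≤ 2 * x.length + 2 + yA.length +
      machinePushBound A.tm * (cA * (williamsBound x.length + yA.length) + cA) := by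
    have := length_le_of_outputsWithin A (hA x yA)
    simp only [hv, List.length_cons, length_boolPair] at this ⊢
    omega
  -- stage 3
  have h3 := hP₃ v g
  -- stage F
  have h4 := hMF (okToken v g)
  -- stage SAT (+ flag, complement): output `[accept]` within `cS T(w) + cS + 3`
  have h5 : (complMachine (flagAux MS fun _ => [true])).OutputsWithin (F (okToken v g))
      [accept F ok out m c (dW + 3) eW q x z]
      (cS * (2 ^ succinctWidth c x.length / succinctWidth c x.length ^ (c + 1)) + cS + 3) ∧
      (okToken v g).length ≤ fInLenB c eG x.length (q x.length) := by
    by_cases hok : ok x yA = true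
    · obtain ⟨G, hG, hout⟩ := hsound x yA hok
      have hGo : ∀ κ, (G κ).IsOver (accBasis m) := fun κ => (hG κ).1
      have hGs : ∀ κ, (G κ).size ≤ succinctWidth c x.length ^ eG + eG :=
        fun κ => (hG κ).2.2.1.trans (by omega)
      have hvt : v = true :: out x yA := by rw [hv, hok]
      have htok : okToken v g = true :: boolPair (out x yA) g := by rw [hvt]; rfl
      have hlen : (okToken v g).length ≤ fInLenB c eG x.length (q x.length) := by
        rw [htok, List.length_cons, length_boolPair]
        have := length_out_le (hsound x yA hok)
        unfold fInLenB; omega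
      refine ⟨?_, hlen⟩
      have hGf : ∀ κ, (G κ).maxFanIn ≤ succinctWidth c x.length ^ eG + eG :=
        fun κ => (hG κ).2.2.2.1.trans (by omega)
      rcases (hF.2 (succinctWidth c x.length) G hGo).1 g with hzero | ⟨W, hWB, hWd, hWs, hWf, hFW⟩
      · -- `F` rejects: answer `[true]`, complemented `[false]`; `accept = false`
        have hacc : accept F ok out m c (dW + 3) eW q x z = false := by
          rw [← Bool.not_eq_true, accept_eq_true_iff]
          rintro ⟨G', W', -, hG'o, hout', -, -, -, hF', -⟩
          have hGG : G' = G := clauseCircuits_eq_of_encode_eq hG'o hGo (hout'.symm.trans hout)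
          subst hGG
          rw [← hyA, ← hg, hout, hzero] at hF'
          exact absurd hF' (by simp)
        rw [hacc, htok, hout, hzero]
        have := flagAux_outputsWithin_answer MS (fun _ => [true]) false
        exact (complMachine_outputsWithin this).mono (by omega)
      · -- `F` prints the instance `D = circuit G W`
        have hspec := circuit_spec hred x G hGo (fun κ => (hG κ).2.1) hGs hGf
          (fun κ => (hG κ).2.2.2.2) W hWB hWd hWs
        obtain ⟨hDo, hDd, hDs, hDf, -, -⟩ := hspec
        have hDsB : (circuit G W).size ≤ dSizeB eG eW (succinctWidth c x.length) := hDs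
        have hDs' : (circuit G W).size ≤ succinctWidth c x.length ^ eD + eD :=
          hDsB.trans (heD _).1
        have hDf' : (circuit G W).maxFanIn ≤ succinctWidth c x.length ^ eD + eD := by
          refine hDf.trans (le_trans ?_ (heD x.length).2)
          have : W.maxFanIn ≤ q x.length := hWf.trans hgq
          omega
        have hS := hMS (succinctWidth c x.length) (circuit G W) hDo (by omega) hDs' hDf'
        have hrun := flagAux_outputsWithin_run MS (fun _ => [true]) hS
        have hcompl := complMachine_outputsWithin hrun
        -- the value of `accept`
        have hacc : accept F ok out m c (dW + 3) eW q x z = !decide (circuit G W).Satisfiable := by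
          by_cases hsat : (circuit G W).Satisfiable
          · rw [decide_eq_true hsat, Bool.not_true, ← Bool.not_eq_true, accept_eq_true_iff]
            rintro ⟨G', W', -, hG'o, hout', hW'B, -, -, hF', hunsat'⟩
            have hGG : G' = G := clauseCircuits_eq_of_encode_eq hG'o hGo (hout'.symm.trans hout)
            subst hGG
            rw [← hyA, ← hg, hout, hFW] at hF'
            simp only [List.cons.injEq, true_and] at hF'
            have hD'o : (circuit G' W').IsOver (accBasis m) :=
              circuit_isOver G' W' (acBasis_subset_accBasis m) hGo hW'B
            have hDD : circuit G' W = circuit G' W' := encodeAccCircuit_injOn m _ hDo hD'o hF'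
            exact hunsat' (hDD ▸ hsat)
          · rw [decide_eq_false hsat, Bool.not_false, accept_eq_true_iff]
            refine ⟨G, W, hok, hGo, hout, hWB, hWd, hWs, ?_, hsat⟩
            rw [← hyA, ← hg, hout, hFW]
        rw [hacc, htok, hout, hFW]
        exact hcompl.mono (by omega)
    · -- the generator rejects: token `00`, `F 00 = 00`, answer `[true]`, complemented `[false]`
      have hokf : ok x yA = false := by simpa using hok
      have hvf : v = false :: out x yA := by rw [hv, hokf]
      have htok : okToken v g = [false, false] := by rw [hvf]; rfl
      have hacc : accept F ok out m c (dW + 3) eW q x z = false := by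
        rw [← Bool.not_eq_true, accept_eq_true_iff]
        rintro ⟨-, -, hok', -⟩
        rw [← hyA] at hok'
        exact hok hok'
      refine ⟨?_, by rw [htok]; unfold fInLenB; simp only [List.length_cons, List.length_nil]; omega⟩
      rw [hacc, htok, hF.1]
      have := flagAux_outputsWithin_answer MS (fun _ => [true]) false
      exact (complMachine_outputsWithin this).mono (by omega)
  obtain ⟨h5, hlen3⟩ := h5
  -- compose
  have h45 := TM2ComputableAux.comp_outputsWithin _ _ h4 h5
  have h345 := TM2ComputableAux.comp_outputsWithin _ _ h3 h45
  have h2345 := TM2ComputableAux.comp_outputsWithin _ _ h2 h345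
  have hall := TM2ComputableAux.comp_outputsWithin _ _ h1 h2345
  refine hall.mono ?_
  -- arithmetic
  have hpF : pF.eval (okToken v g).length ≤ pF.eval (fInLenB c eG x.length (q x.length)) :=
    natPoly_eval_mono pF hlen3
  have hl1 : (boolPair (boolPair x (ones (q x.length))) z).length =
      4 * x.length + 6 + 2 * q x.length + z.length := by
    simp only [length_boolPair, List.length_replicate]; ring
  have hl2 : (boolPair (boolPair x yA) g).length ≤ 4 * x.length + 6 + 2 * z.length + q x.length := by
    simp only [length_boolPair]; omega
  have htA' : cA * (williamsBound x.length + yA.length) + cA ≤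
      cA * (williamsBound x.length + z.length) + cA := by gcongr
  have hmul := Nat.mul_le_mul_left (machinePushBound A.tm) htA'
  have hv' : v.length ≤ 2 * x.length + 2 + z.length +
      machinePushBound A.tm * (cA * (williamsBound x.length + z.length) + cA) := by omega
  have hl3 : (boolPair v g).length ≤
      2 * (2 * x.length + 2 + z.length +
        machinePushBound A.tm * (cA * (williamsBound x.length + z.length) + cA)) + 2 + q x.length := by
    rw [length_boolPair]; omega
  have e3 := Nat.mul_le_mul_left C₃ hl3
  unfold coreTime
  rw [hl1] at hall ⊢
  omega

end MachineB

/-! ### Polynomial bounds for the yardstick, the input of `F` and the class of `D` -/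

namespace MachineB

open WitnessCheck TM2Comp

/-- `codeLen` as a polynomial in three polynomial arguments. [folklore] -/
noncomputable def codeLenPoly (W S P : Polynomial ℕ) : Polynomial ℕ :=
  C 2 + (C 4 + S * (C 2 * P + C 2)) * (C 2 * (W + S + P) + C 14)

/-- Evaluation of `codeLenPoly`. [folklore] -/
@[simp] theorem eval_codeLenPoly (W S P : Polynomial ℕ) (n : ℕ) :
    (codeLenPoly W S P).eval n = codeLen (W.eval n) (S.eval n) (P.eval n) := by
  simp [codeLenPoly, codeLen]

/-- The width bound `(c + 1) n + c ≥ succinctWidth c n` as a polynomial. [folklore] -/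
noncomputable def widthPoly (c : ℕ) : Polynomial ℕ := C (c + 1) * X + C c

/-- Evaluation of `widthPoly`. [folklore] -/
@[simp] theorem eval_widthPoly (c n : ℕ) : (widthPoly c).eval n = (c + 1) * n + c := by
  simp [widthPoly]

/-- `succinctWidth c n ≤ widthPoly c (n)`. [folklore] -/
theorem succinctWidth_le_widthPoly (c n : ℕ) : succinctWidth c n ≤ (widthPoly c).eval n := by
  rw [eval_widthPoly]; exact succinctWidth_le c n

/-- `wSize e` of the width bound, as a polynomial. [folklore] -/
noncomputable def wSizePoly (c e : ℕ) : Polynomial ℕ := widthPoly c ^ e + C e + widthPoly c + C 2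

/-- Evaluation of `wSizePoly`. [folklore] -/
@[simp] theorem eval_wSizePoly (c e n : ℕ) : (wSizePoly c e).eval n = wSize e ((widthPoly c).eval n) := by
  simp [wSizePoly, wSize]

/-- **The yardstick polynomial** `q`: `codeLen w (wSize e w) (m (w + wSize e w)) ≤ q(n)` for
`w = succinctWidth c n` (`codeLen_le_yardPoly`). [folklore] -/
noncomputable def yardPoly (c m e : ℕ) : Polynomial ℕ :=
  codeLenPoly (widthPoly c) (wSizePoly c e) (C m * (widthPoly c + wSizePoly c e))

/-- The code of an admissible witness fits the yardstick. [folklore] -/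
theorem codeLen_le_yardPoly (c m e n : ℕ) :
    codeLen (succinctWidth c n) (wSize e (succinctWidth c n))
      (m * (succinctWidth c n + wSize e (succinctWidth c n))) ≤ (yardPoly c m e).eval n := by
  have hw := succinctWidth_le_widthPoly c n
  have hs : wSize e (succinctWidth c n) ≤ wSize e ((widthPoly c).eval n) := wSize_mono hw
  rw [yardPoly, eval_codeLenPoly, eval_wSizePoly]
  refine codeLen_mono hw hs ?_
  simp only [eval_mul, eval_C, eval_add, eval_wSizePoly]
  exact Nat.mul_le_mul_left m (Nat.add_le_add hw hs)

/-- The bound `outLenB` as a polynomial. [folklore] -/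
noncomputable def outPoly (c eG : ℕ) : Polynomial ℕ :=
  C 2 + C 3 * (widthPoly c + C 2) *
    (C 2 * codeLenPoly (widthPoly c) (widthPoly c ^ eG + C eG) (widthPoly c ^ eG + C eG) + C 4)

/-- `outLenB ≤ outPoly`. [folklore] -/
theorem outLenB_le_outPoly (c eG n : ℕ) : outLenB c eG n ≤ (outPoly c eG).eval n := by
  have hw := succinctWidth_le_widthPoly c n
  have hp : succinctWidth c n ^ eG + eG ≤ (widthPoly c).eval n ^ eG + eG :=
    Nat.add_le_add_right (Nat.pow_le_pow_left hw _) _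
  unfold outLenB
  simp only [outPoly, eval_add, eval_mul, eval_C, eval_codeLenPoly, eval_pow]
  have hc := codeLen_mono hw hp hp
  gcongr

/-- The bound `fInLenB` at the yardstick, as a polynomial. [folklore] -/
noncomputable def inPoly (c m eW eG : ℕ) : Polynomial ℕ := C 3 + C 2 * outPoly c eG + yardPoly c m eW

/-- `fInLenB ≤ inPoly` at the yardstick. [folklore] -/
theorem fInLenB_le_inPoly (c m eW eG n : ℕ) :
    fInLenB c eG n ((yardPoly c m eW).eval n) ≤ (inPoly c m eW eG).eval n := by
  unfold fInLenB
  simp only [inPoly, eval_add, eval_mul, eval_C]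
  have := outLenB_le_outPoly c eG n
  omega

/-- The size bound `dSizeB` as a polynomial in the width. [folklore] -/
noncomputable def dPoly (eG eW : ℕ) : Polynomial ℕ :=
  C 3 * (X + C 2) * (X ^ eG + C eG) + C 3 * (X ^ eW + C eW + X + C 2) + C 20

/-- Evaluation of `dPoly`. [folklore] -/
@[simp] theorem eval_dPoly (eG eW w : ℕ) : (dPoly eG eW).eval w = dSizeB eG eW w := by
  simp [dPoly, dSizeB, wSize]

/-- **One exponent for the class of the SAT instances**: the size of `D` and its fan-in bound
`(w^{e_G} + e_G) + q(n) + 3` (clause circuits, the guessed `W` cut at the yardstick, gadgets) are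
`≤ w^{e_D} + e_D`, `w = succinctWidth c n`. [folklore] -/
theorem exists_dExp (c m eG eW : ℕ) :
    ∃ eD, ∀ n, dSizeB eG eW (succinctWidth c n) ≤ succinctWidth c n ^ eD + eD ∧
      succinctWidth c n ^ eG + eG + (yardPoly c m eW).eval n + 3 ≤ succinctWidth c n ^ eD + eD := by
  obtain ⟨eD, h⟩ := exists_eval_le_pow_add_self (dPoly eG eW + (X ^ eG + C eG + yardPoly c m eW + C 3))
  refine ⟨eD, fun n => ?_⟩
  have := h (succinctWidth c n)
  have hq : (yardPoly c m eW).eval n ≤ (yardPoly c m eW).eval (succinctWidth c n) :=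
    natPoly_eval_mono _ (le_succinctWidth c n)
  simp only [eval_add, eval_pow, eval_C, eval_X, eval_dPoly] at this
  constructor <;> omega

/-! ### The running time is `O(n + 2ⁿ/n)` -/

/-- Affine images `k a + k`. [folklore] -/
theorem LeAff.affine {a K T : ℕ} (h : LeAff a K T) (k : ℕ) : LeAff (k * a + k) (k * K + k) T :=
  (h.mul k).add (LeAff.const k T)

/-- **The core machine runs in time `O(williamsBound n)`** on certificates of length `O(williamsBound n)`.
[folklore] -/
theorem coreTime_le (C₁ C₃ cA DA cS c eG : ℕ) (pF : Polynomial ℕ) (q : ℕ → ℕ) (cq cF cz : ℕ)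
    (hq : ∀ n, q n ≤ cq * williamsBound n + cq)
    (hpF : ∀ n, pF.eval (fInLenB c eG n (q n)) ≤ cF * williamsBound n + cF) :
    ∃ K, ∀ n Z, Z ≤ cz * williamsBound n + cz →
      coreTime C₁ C₃ cA DA cS c eG pF q n Z ≤ K * williamsBound n + K := by
  refine ⟨C₁ * (4 * 1 + 6 + 2 * cq + cz) + C₁ +
      (cA * (1 + cz) + cA + 3 * (2 * 1 + 2 + cz + DA * (cA * (1 + cz) + cA)) +
        2 * (4 * 1 + 6 + 2 * cz + cq) + 6) +
      (C₃ * (2 * (2 * 1 + 2 + cz + DA * (cA * (1 + cz) + cA)) + 2 + cq) + C₃) + cF +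
      (cS * 2 ^ c + cS + 3), fun n Z hZ => ?_⟩
  have hT : LeAff (williamsBound n) 1 (williamsBound n) := LeAff.self _
  have hn : LeAff n 1 (williamsBound n) := hT.of_le (le_williamsBound n)
  have hqn : LeAff (q n) cq (williamsBound n) := hq n
  have hZ' : LeAff Z cz (williamsBound n) := hZ
  have hF' : LeAff (pF.eval (fInLenB c eG n (q n))) cF (williamsBound n) := hpF n
  have hS : LeAff (cS * (2 ^ succinctWidth c n / succinctWidth c n ^ (c + 1)) + cS + 3)
      (cS * 2 ^ c + cS + 3) (williamsBound n) := by
    have := satTime_le_williamsBound cS c n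
    unfold LeAff; nlinarith [this]
  -- stage 1
  have i1 : LeAff (4 * n + 6 + 2 * q n + Z) (4 * 1 + 6 + 2 * cq + cz) (williamsBound n) :=
    (((hn.mul 4).add (LeAff.const 6 _)).add (hqn.mul 2)).add hZ'
  have t1 := i1.affine C₁
  -- stage 2
  have tA : LeAff (cA * (williamsBound n + Z) + cA) (cA * (1 + cz) + cA) (williamsBound n) :=
    (hT.add hZ').affine cA
  have vB : LeAff (2 * n + 2 + Z + DA * (cA * (williamsBound n + Z) + cA))
      (2 * 1 + 2 + cz + DA * (cA * (1 + cz) + cA)) (williamsBound n) :=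
    (((hn.mul 2).add (LeAff.const 2 _)).add hZ').add (tA.mul DA)
  have i2 : LeAff (4 * n + 6 + 2 * Z + q n) (4 * 1 + 6 + 2 * cz + cq) (williamsBound n) :=
    (((hn.mul 4).add (LeAff.const 6 _)).add (hZ'.mul 2)).add hqn
  have t2 := ((tA.add (vB.mul 3)).add (i2.mul 2)).add (LeAff.const 6 (williamsBound n))
  -- stage 3
  have i3 := ((vB.mul 2).add (LeAff.const 2 (williamsBound n))).add hqn
  have t3 := i3.affine C₃
  -- all
  have := (((t1.add t2).add t3).add hF').add hS
  exact this.le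

end MachineB

/-! ### The machine `B` -/

open MachineB WitnessCheck TM2Comp in
/-- **Williams 2014, proof of Thm. 3.2: the machine `B` from its stages.** Given linear-time
machines for stage 1 (`ReassocMachine`) and stage 3 (`OkDispatchMachine`) and, for all
parameters, an `FP` function with `SatInstanceFn.Spec` (stage `F`), the named fact
`Williams2014_thm_3_2_machineB` holds with exponent `k = c + 1`: for `L` with a succinct
reduction of constant `c`, a generator of the clause circuits (`NGenerates`, Lemma 3.1),
succinct `ACC` witnesses and `ACC`-SAT algorithms in time `O(2ⁿ/n^{c+1})`, the verifier
`truncMapAux N' ▸ P₁ ▸ mapFstAux A ▸ P₃ ▸ M_F ▸ compl (flagAux M_SAT)` places `L` in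
`NTIME(n + 2ⁿ/n)` (`mem_NTIME_of_prefixMachine_pre`, `core_outputsWithin`, `accept_iff`,
`coreTime_le`). [cite: Williams2014, proof of Thm. 3.2 (pp. 12–13)] -/
theorem Williams2014_thm_3_2_machineB_of_stages
    (h₁ : ∃ (P₁ : TM2ComputableAux Bool Bool) (C₁ : ℕ), ReassocMachine P₁ C₁)
    (h₃ : ∃ (P₃ : TM2ComputableAux Bool Bool) (C₃ : ℕ), OkDispatchMachine P₃ C₃)
    (hF : ∀ m dW e : ℕ, ∃ F : List Bool → List Bool, F ∈ FP ∧ SatInstanceFn.Spec m dW e F) :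
    Williams2014_thm_3_2_machineB := by
  intro c
  refine ⟨c + 1, fun L cl m dG eG dW hred hm hgen hWacc hsat => ?_⟩
  obtain ⟨cA, ok, out, A, hA, hsound, hcompl⟩ := hgen
  obtain ⟨eW, hWit⟩ := hWacc
  obtain ⟨F, ⟨pF, MF, hMF⟩, hFspec⟩ := hF m (dW + 3) eW
  obtain ⟨P₁, C₁, hP₁⟩ := h₁
  obtain ⟨P₃, C₃, hP₃⟩ := h₃
  have hm0 : 0 < m := by omega
  -- the SAT machine for the class of the instances `D`
  obtain ⟨eD, heD⟩ := exists_dExp c m eG eW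
  obtain ⟨cS, MS, hMS⟩ := hsat (dW + 3 + dG + 4) eD
  -- the yardstick, the certificate length and its clock
  obtain ⟨cq, hcq⟩ := exists_poly_le_id_add_two_pow_div (yardPoly c m eW)
  obtain ⟨cF, hcF⟩ := exists_poly_le_id_add_two_pow_div (pF.comp (inPoly c m eW eG))
  replace hcq : ∀ n, (yardPoly c m eW).eval n ≤ cq * williamsBound n + cq := hcq
  replace hcF : ∀ n, (pF.comp (inPoly c m eW eG)).eval n ≤ cF * williamsBound n + cF := hcF
  have hTC : IsTimeConstructible fun n => (2 * cA + cq + 2) * williamsBound n + (2 * cA + cq + 2) :=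
    isTimeConstructible_williamsBound.mul_add (by omega)
  obtain ⟨N, aN, hN⟩ := exists_unaryClock_of_timeConstructible hTC
  -- the preprocessing `x ↦ ⟨x, 1^{q n}⟩`
  have hpre : fanoutFn id (Plumb.polyFn (yardPoly c m eW)) ∈ FP :=
    fanoutFn_mem_FP OracleCompose.id_mem_FP (Plumb.polyFn_mem_FP _)
  obtain ⟨pP, MP, hMP⟩ := hpre
  obtain ⟨cP, hcP⟩ := exists_poly_le_id_add_two_pow_div pP
  replace hcP : ∀ n, pP.eval n ≤ cP * williamsBound n + cP := hcP
  -- the core time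
  have hpF : ∀ n, pF.eval (fInLenB c eG n ((yardPoly c m eW).eval n)) ≤ cF * williamsBound n + cF := by
    intro n
    refine (natPoly_eval_mono pF (fInLenB_le_inPoly c m eW eG n)).trans ?_
    rw [← eval_comp]
    exact hcF n
  obtain ⟨K, hK⟩ := coreTime_le C₁ C₃ cA (machinePushBound A.tm) cS c eG pF
    (fun n => (yardPoly c m eW).eval n) cq cF (2 * cA + cq + 2) hcq hpF
  -- the total time is `O(williamsBound n)`
  obtain ⟨cB, hcB⟩ : ∃ cB, ∀ n,
      (pP.eval n + 3 * (2 * n + 2 + (yardPoly c m eW).eval n) +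
          2 * (2 * n + 2 + ((2 * cA + cq + 2) * williamsBound n + (2 * cA + cq + 2))) + 6) +
        (aN * ((2 * cA + cq + 2) * williamsBound n + (2 * cA + cq + 2)) + aN) +
        (K * williamsBound n + K) +
        ((2 * cA + cq + 2) * williamsBound n + (2 * cA + cq + 2)) +
        (2 * n + 2 + (yardPoly c m eW).eval n) + n ≤ cB * williamsBound n + cB := by
    refine ⟨cP + 3 * (2 * 1 + 2 + cq) + 2 * (2 * 1 + 2 + (2 * cA + cq + 2)) + 6 +
      (aN * (2 * cA + cq + 2) + aN) + K + (2 * cA + cq + 2) + (2 * 1 + 2 + cq) + 1, fun n => ?_⟩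
    have hn : LeAff n 1 (williamsBound n) := (LeAff.self _).of_le (le_williamsBound n)
    have hq : LeAff ((yardPoly c m eW).eval n) cq (williamsBound n) := hcq n
    have hP : LeAff (pP.eval n) cP (williamsBound n) := hcP n
    have hsx : LeAff ((2 * cA + cq + 2) * williamsBound n + (2 * cA + cq + 2)) (2 * cA + cq + 2)
        (williamsBound n) := le_refl _
    have hK' : LeAff (K * williamsBound n + K) K (williamsBound n) := le_refl _
    have l1 : LeAff (2 * n + 2 + (yardPoly c m eW).eval n) (2 * 1 + 2 + cq) (williamsBound n) :=
      ((hn.mul 2).add (LeAff.const 2 _)).add hq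
    have l2 : LeAff (2 * n + 2 + ((2 * cA + cq + 2) * williamsBound n + (2 * cA + cq + 2)))
        (2 * 1 + 2 + (2 * cA + cq + 2)) (williamsBound n) :=
      ((hn.mul 2).add (LeAff.const 2 _)).add hsx
    have t1a := ((hP.add (l1.mul 3)).add (l2.mul 2)).add (LeAff.const 6 (williamsBound n))
    have t1b := hsx.affine aN
    exact (((((t1a.add t1b).add hK').add hsx).add l1).add hn).le
  -- assemble
  refine mem_NTIME_of_prefixMachine_pre
    (fun x => boolPair x (ones ((yardPoly c m eW).eval x.length)))
    (fun x => (2 * cA + cq + 2) * williamsBound x.length + (2 * cA + cq + 2))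
    (accept F ok out m c (dW + 3) eW fun n => (yardPoly c m eW).eval n)
    (N.comp (mapFstAux MP))
    (P₁.comp ((mapFstAux A).comp (P₃.comp (MF.comp (complMachine (flagAux MS fun _ => [true]))))))
    (fun x => (pP.eval x.length + 3 * (2 * x.length + 2 + (yardPoly c m eW).eval x.length) +
        2 * (2 * x.length + 2 + ((2 * cA + cq + 2) * williamsBound x.length + (2 * cA + cq + 2))) + 6) +
      (aN * ((2 * cA + cq + 2) * williamsBound x.length + (2 * cA + cq + 2)) + aN))
    (fun x => K * williamsBound x.length + K) ?_ ?_ ?_ cB ?_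
  · -- the clock followed by the preprocessing
    intro x
    have h1 := hN x
    have h2 : MP.OutputsWithin
        (boolUnpair (boolPair x (List.replicate ((2 * cA + cq + 2) * williamsBound x.length +
          (2 * cA + cq + 2)) true))).1
        (boolPair x (ones ((yardPoly c m eW).eval x.length))) (pP.eval x.length) := by
      rw [boolUnpair_boolPair]
      have := hMP x
      simpa using this
    have h3 := outputsWithin_mapFstAux MP h2
    rw [readRest_boolPair] at h3
    refine (TM2ComputableAux.comp_outputsWithin _ _ h1 h3).mono (le_of_eq ?_)
    simp only [length_boolPair, List.length_replicate]
  · -- the core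
    intro x z hz
    exact (core_outputsWithin hred hP₁ hP₃ hA hsound hMF hFspec hMS _ heD x z).mono
      (hK x.length z.length hz)
  · -- correctness
    exact accept_iff hred hm0 hsound hcompl hWit hFspec _ (codeLen_le_yardPoly c m eW) _
      fun x => by have := hcq x.length; nlinarith [this]
  · -- the total is `O(williamsBound n)`
    intro x
    have := hcB x.length
    simp only [length_boolPair, List.length_replicate]
    omega

end Literature.Computability.Complexity
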